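import Summits.BirchSwinnertonDyer.BirchSwinnertonDyer.Theorems.AlignedTransportAtTwoMainConjectureOfRankZeroBSDAtTwoLayerValueDoor
import HarnessLib

/-!
# Route `AlignedTransportAtTwo`, crux C2 `MainConjectureOfRankZeroBSDAtTwo` (stmt-BirchSwinnertonDyer-22298):
# THE DOUBLY-DARK TWIN `(2, 2)` EXCLUDES `λ = 2` — for an `ι`-stable `F ∈ ℤ_p⟦T⟧` with `μ(F) = 0` and `λ(F) = 2` the distinguished
# polynomial is `T² + qT + q`; at `p = 2` this forces `(ord₂ F(0), ord₂ F(−2)) ∈ {(1,1), (2, ≥3), (≥3, 2)}`, so a class with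
# `ord₂ f_X(0) = ord₂ f_X(−2) = 2` («doubly dark», g49) has `μ ≥ 1` or `λ ≥ 4`: the first layer value that can light it is at LAYER 3

HONEST FRAMING (cell `bsd-f1-sign2`, WIDTH-5 attached prover seat `bsd-line-att-p5` gen 50 on line `birth` of the lead
`bsd-line-att-p2`; `--supports` stmt-BirchSwinnertonDyer-22298, closes nothing; BSD is NOT proved by any of this; the crux C2, its
verdict «blocked-on `Rank1Residual.GreenbergMuConjectureIrreducible`» and every registered stub (P / T / Kμ / LimDoor / MuIneqʳ / PFμ⁺)
are untouched). THEOREMS ONLY — no `def`, no instance, no named fact, no `sorry`. §1 is pure Λ-algebra (any `p`; Mathlib's uniqueness of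
the Weierstrass factorisation + the tree's involution `ι T = (1+T)⁻¹ − 1`); §2 is `p = 2`; §3 reads it on C2's datum with the PRINT binder
`h114` (Greenberg Thm. 1.14, `ι`-invariance of `char_Λ X`) exactly as g49's `…TwinValue`.

THE POINT (explains this gen's census: of g49's 113 «doubly dark» clean seeds, the 14 present in bsd-2adic's S2TOWER table have
`λ_an ∈ {4, 6, 8, 10}`, never `2`, while the LIT seeds have `λ_an = 2`). Let `F = P·U`, `P = T² + p₁T + p₀` distinguished, and suppose
`(ι F) = (F)`. Since `ι T·(1+T) = −T`, **`(1+T)²·ι(P) = (1 − p₁ + p₀)T² + (2p₀ − p₁)T + p₀ =: Q`**, and `Q = P·w` for a unit `w`; but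
`Q = c·P₂` with `c = 1 − p₁ + p₀ ∈ ℤ_pˣ` and `P₂` distinguished, so uniqueness of the Weierstrass factorisation gives `P₂ = P`, whence
`c = 1`, i.e. **`p₀ = p₁ =: q`** (`coeff_zero_eq_coeff_one_of_invol`; equivalently `P(−1) = 1`). At `p = 2`: `F(0) = q·unit`,
`F(−2) = (4 − q)·unit` (`constantCoeff_and_evalAt_neg_two_eq`), so `(ord₂ F(0), ord₂ F(−2)) = (v(q), v(4 − q))` is `(1,1)`, `(2, ≥3)` or `(≥3, 2)`:
* ★★★ `eight_dvd_evalAt_neg_two_of_lam_eq_two`: **`ι`-stable, `μ(F) = 0`, `λ(F) = 2`, `4 ∣ F(0)`, `8 ∤ F(0)` ⟹ `8 ∣ F(−2)`** (so `F(−2) = 0`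
  — Matsuno's `(T+2)²` — or `ord₂ F(−2) ≥ 3`).
* ★★★ `lam_ne_two_of_twin_two_two` / `four_le_lam_of_twin_two_two`: **`ι`-stable, `F(0), F(−2)` both of order exactly `2` ⟹ `λ(F) ≠ 2`**, and
  with `μ(F) = 0` (g49's parity `even_lam_of_iotaStable` supplies evenness) **`λ(F) ≥ 4`**.
* §3 (C2 datum, `p = 2`, PRINT `h114`): on the clean doubly-dark cell (`e(W) = 2`, twin value `ord₂ f_X(−2) = 2` displayed) ★★★
  `four_le_lambda_of_doublyDark_of_mu_eq_zero`: **`μ(X(W/ℚ_∞)) = 0 ⟹ λ(X(W/ℚ_∞)) ≥ 4`**; contrapositive `one_le_mu_of_doublyDark_of_lambda_le_three`.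
  So the irreducible residue of the lineage is `{μ ≥ 1} ∪ {μ = 0, λ ≥ 4}`; the layer-2 value door (`λ = 2`) is provably silent there and the
  first boundary door that can fire is LAYER 3 (`‖f_X(ζ₈ − 1)‖₂ = 1/2 ⟺ μ = 0 ∧ λ = 4`, sibling `…LayerValueDoor`); and the KATO-CONSISTENCY LAW
  «doubly dark ∧ λ_an ≤ 3 ⟹ μ_alg ≥ 1» makes «a doubly-dark seed with λ_an = 2» a counterexample to Greenberg's `μ`-conjecture (0 of 14 observed).
This corrects g49's memo `TWIN-VALUE-att-p5-g49.md` §2, whose «μ = 0, λ = 2» doubly-dark shapes (`T² + 2T + 4`, `(T − r)(T − ιr)` with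
`ord(2 + r) = 1`) are NOT `ι`-stable. Memo `Cruxes/MainConjectureOfRankZeroBSDAtTwo/LAYER-VALUE-att-p5-g50.md`. BSD is not proved by any of this.

References: L. Washington, GTM 83, §7.1 (Weierstrass preparation, uniqueness) [Washington1997]; B. Mazur, J. Tate, J. Teitelbaum, Invent.
Math. 84 (1986) Ch. I §17 (the involution) [MazurTateTeitelbaum1986Invent]; R. Greenberg, LNM 1716 (1999), Thm. 1.14, Thm. 4.1, §5 p. 181
[GreenbergLNM1716]; K. Matsuno, IJNT 4 (2008) Example 2 [Matsuno2008].
-/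

set_option linter.dupNamespace false
set_option autoImplicit false

noncomputable section

open scoped Classical MatrixGroups ModularForm

namespace Summit.BirchSwinnertonDyer.BirchSwinnertonDyer.Theorems.AlignedTransportAtTwoLayerValueDoublyDark

open PowerSeries CongruenceSubgroup WeierstrassCurve Literature.NumberTheory.EllipticCurves
  Literature.NumberTheory.EllipticCurves.IwasawaAlgebra
  Literature.NumberTheory.EllipticCurves.ModularForms
  Literature.NumberTheory.EllipticCurves.Rank1Residual
  Literature.NumberTheory.EllipticCurves.Rank1Residual.Typed
  Literature.NumberTheory.EllipticCurves.Greenberg1999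
  Summit.BirchSwinnertonDyer.Rank1Residual
  Summit.BirchSwinnertonDyer.Rank1Residual.X1.MuLambda
  Summit.BirchSwinnertonDyer.Rank1Residual.X1.MuPart
  Summit.BirchSwinnertonDyer.Rank1Residual.X1.ParitySqueeze
  Summit.BirchSwinnertonDyer.Rank1Residual.X5
  Summit.BirchSwinnertonDyer.Rank1Residual.F1Sign2
  Summit.BirchSwinnertonDyer.Rank1Residual.Iwasawa
  Summit.BirchSwinnertonDyer.Rank1Residual.Supersingular
  Summit.BirchSwinnertonDyer.Rank1Residual.Supersingular.BlindLever
  Summit.BirchSwinnertonDyer.BirchSwinnertonDyer.Theorems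
  Summit.BirchSwinnertonDyer.BirchSwinnertonDyer.Theorems.Rank1ResidualX1Defs
  Summit.BirchSwinnertonDyer.BirchSwinnertonDyer.Theorems.AlignedTransportAtTwoSeed
  Summit.BirchSwinnertonDyer.BirchSwinnertonDyer.Theorems.AlignedTransportAtTwoCyclotomicLayerWeightEuler
  Summit.BirchSwinnertonDyer.BirchSwinnertonDyer.Theorems.AlignedTransportAtTwoTwistSaturation
  Summit.BirchSwinnertonDyer.BirchSwinnertonDyer.Theorems.AlignedTransportAtTwoTwinValueAlgebra
  Summit.BirchSwinnertonDyer.BirchSwinnertonDyer.Theorems.AlignedTransportAtTwoTwinValue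
  Summit.BirchSwinnertonDyer.BirchSwinnertonDyer.Theorems.AlignedTransportAtTwoTwinValueParity
  Summit.BirchSwinnertonDyer.BirchSwinnertonDyer.Theorems.AlignedTransportAtTwoTwinValueLambda
  Summit.BirchSwinnertonDyer.BirchSwinnertonDyer.Theorems.TwoAdicEulerCharKernel

/-! ## §1 Any `p`: an `ι`-stable element of `λ = 2` has distinguished polynomial `T² + qT + q` -/

section AnyPrime

variable {p : ℕ} [hp : Fact p.Prime]

/-- **The involution on a quadratic distinguished polynomial**: for `P = T² + p₁T + p₀` (as a power series),
`(1+T)²·ι(P) = (1 − p₁ + p₀)T² + (2p₀ − p₁)T + p₀`, from `ι T·(1+T) = −T`. [cite: MazurTateTeitelbaum1986Invent, Ch. I §17] -/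
theorem one_add_X_sq_mul_invol_quadratic (p₁ p₀ : ℤ_[p]) :
    ((1 : IwasawaAlgebra p) + X) ^ 2 * invol p (X ^ 2 + C p₁ * X + C p₀) =
      C (1 - p₁ + p₀) * X ^ 2 + C (2 * p₀ - p₁) * X + C p₀ := by
  have hS : invol p PowerSeries.X * (1 + PowerSeries.X) = -PowerSeries.X := invol_X_mul_one_add_X p
  simp only [map_add, map_mul, map_pow, map_sub, map_one, invol_C, map_ofNat]
  linear_combination (invol p X * (1 + X) - X + C p₁ * (1 + X)) * hS

/-- ★★ **`ι`-stability at `λ = 2` pins the distinguished polynomial to `T² + qT + q`.** For `F ∈ Λ = ℤ_p⟦T⟧` with `F ≢ 0 (mod p)`,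
`λ(F) = 2`, `F(0) ≠ 0` and `(ι F) = (F)` (`ι F = u·F`, `u ∈ Λˣ`): the distinguished polynomial `P = T² + p₁T + p₀` of `F` has **`p₀ = p₁`**
(equivalently `P(−1) = 1`). Proof: `(1+T)²·ι(P) = Q := (1 − p₁ + p₀)T² + (2p₀ − p₁)T + p₀` equals `P·(unit)` by `ι`-stability and
`c⁻¹Q·c` with `c = 1 − p₁ + p₀ ∈ ℤ_pˣ`, `c⁻¹Q` distinguished; uniqueness of the Weierstrass factorisation gives `c⁻¹Q = P`, so `c = 1`.
[cite: Washington1997, §7.1 (Weierstrass preparation, uniqueness)] [cite: MazurTateTeitelbaum1986Invent, Ch. I §17] -/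
theorem coeff_zero_eq_coeff_one_of_invol {F : IwasawaAlgebra p} (hred : F.map (IsLocalRing.residue ℤ_[p]) ≠ 0) (hlam : lam F = 2)
    (h0 : PowerSeries.constantCoeff F ≠ 0) (hι : ∃ u : (IwasawaAlgebra p)ˣ, invol p F = u * F) :
    (F.weierstrassDistinguished hred).coeff 0 = (F.weierstrassDistinguished hred).coeff 1 := by
  set P : Polynomial ℤ_[p] := F.weierstrassDistinguished hred with hP
  set h : IwasawaAlgebra p := F.weierstrassUnit hred with hh
  have hPd : P.IsDistinguishedAt (IsLocalRing.maximalIdeal ℤ_[p]) := F.isDistinguishedAt_weierstrassDistinguished hred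
  have hhU : IsUnit h := F.isUnit_weierstrassUnit hred
  have hfac : F = (P : IwasawaAlgebra p) * h := F.eq_weierstrassDistinguished_mul_weierstrassUnit hred
  -- `deg P = λ(F) = 2`
  have hdeg : P.natDegree = 2 := by
    have hF1 : F = PowerSeries.C ((p : ℤ_[p]) ^ 0) * F := by rw [pow_zero, map_one, one_mul]
    rw [← hlam, lam_eq_natDegree_weierstrassDistinguished hF1 hred]
  set p₀ : ℤ_[p] := P.coeff 0 with hp₀
  set p₁ : ℤ_[p] := P.coeff 1 with hp₁
  have hm₀ : p₀ ∈ IsLocalRing.maximalIdeal ℤ_[p] := hPd.mem (by rw [hdeg]; norm_num)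
  have hm₁ : p₁ ∈ IsLocalRing.maximalIdeal ℤ_[p] := hPd.mem (by rw [hdeg]; norm_num)
  have hPeq : P = Polynomial.X ^ 2 + Polynomial.C p₁ * Polynomial.X + Polynomial.C p₀ := by
    have h := hPd.monic.as_sum
    rw [hdeg] at h
    rw [h]
    simp [Finset.sum_range_succ]
    ring
  -- `p₀ ≠ 0` since `F(0) = p₀·h(0) ≠ 0`
  have hp₀ne : p₀ ≠ 0 := by
    intro h0'
    apply h0
    rw [hfac, map_mul, Polynomial.constantCoeff_coe, ← hp₀, h0', zero_mul]
  -- the key identity in `Λ`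
  set c : ℤ_[p] := 1 - p₁ + p₀ with hc
  set Q : Polynomial ℤ_[p] := Polynomial.C c * Polynomial.X ^ 2 + Polynomial.C (2 * p₀ - p₁) * Polynomial.X + Polynomial.C p₀
    with hQ
  have hkey : ((1 : IwasawaAlgebra p) + X) ^ 2 * invol p (P : IwasawaAlgebra p) = (Q : IwasawaAlgebra p) := by
    rw [hPeq, hQ, hc]
    push_cast
    exact one_add_X_sq_mul_invol_quadratic p₁ p₀
  -- first Weierstrass factorisation of `Q`: `Q = P · ((1+T)² u h (ι h)⁻¹)`
  obtain ⟨u, hu⟩ := hι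
  have hιh : IsUnit (invol p h) := hhU.map (invol p)
  have h1X : IsUnit ((1 : IwasawaAlgebra p) + X) := by
    rw [PowerSeries.isUnit_iff_constantCoeff, map_add, map_one, constantCoeff_X, add_zero]
    exact isUnit_one
  set ih : IwasawaAlgebra p := ((hιh.unit⁻¹ : (IwasawaAlgebra p)ˣ) : IwasawaAlgebra p) with hih
  have hihU : IsUnit ih := Units.isUnit _
  have hih1 : invol p h * ih = 1 := by rw [hih]; exact IsUnit.mul_val_inv hιh
  have hιP : invol p (P : IwasawaAlgebra p) = (u : IwasawaAlgebra p) * ((P : IwasawaAlgebra p) * h) * ih := by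
    have e1 : invol p F = invol p (P : IwasawaAlgebra p) * invol p h := by rw [hfac, map_mul]
    calc invol p (P : IwasawaAlgebra p)
        = invol p (P : IwasawaAlgebra p) * (invol p h * ih) := by rw [hih1, mul_one]
      _ = (invol p (P : IwasawaAlgebra p) * invol p h) * ih := by ring
      _ = (u : IwasawaAlgebra p) * ((P : IwasawaAlgebra p) * h) * ih := by rw [← e1, hu, hfac]
  set w : IwasawaAlgebra p := ((1 : IwasawaAlgebra p) + X) ^ 2 * (u : IwasawaAlgebra p) * h * ih with hw
  have hwU : IsUnit w := (((h1X.pow 2).mul u.isUnit).mul hhU).mul hihU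
  have hQ1 : (Q : IwasawaAlgebra p).IsWeierstrassFactorization P w := by
    refine ⟨hPd, hwU, ?_⟩
    rw [← hkey, hιP, hw]; ring
  -- second Weierstrass factorisation: `Q = (c⁻¹ Q) · c`, `c` a unit, `c⁻¹ Q` distinguished
  have hcU : IsUnit c := by
    by_contra hcn
    have hcm : c ∈ IsLocalRing.maximalIdeal ℤ_[p] := (IsLocalRing.mem_maximalIdeal c).mpr (mem_nonunits_iff.mpr hcn)
    have h1 : (1 : ℤ_[p]) ∈ IsLocalRing.maximalIdeal ℤ_[p] := by
      have : (1 : ℤ_[p]) = c + p₁ - p₀ := by rw [hc]; ring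
      rw [this]
      exact Ideal.sub_mem _ (Ideal.add_mem _ hcm hm₁) hm₀
    exact (Ideal.ne_top_iff_one _).mp (IsLocalRing.maximalIdeal.isMaximal ℤ_[p]).ne_top h1
  obtain ⟨cu, hcu⟩ := hcU
  set P₂ : Polynomial ℤ_[p] := Polynomial.C (↑cu⁻¹ : ℤ_[p]) * Q with hP₂
  have hcne : c ≠ 0 := by rw [← hcu]; exact cu.ne_zero
  have hQdeg : Q.natDegree = 2 := by rw [hQ]; exact Polynomial.natDegree_quadratic hcne
  have hQ2 : Q.coeff 2 = c := by rw [hQ]; simp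
  have hQ1c : Q.coeff 1 = 2 * p₀ - p₁ := by rw [hQ]; simp
  have hQ0 : Q.coeff 0 = p₀ := by rw [hQ]; simp
  have hinv : (↑cu⁻¹ : ℤ_[p]) * c = 1 := by rw [← hcu, Units.inv_mul]
  have hP₂deg : P₂.natDegree = 2 := by rw [hP₂, Polynomial.natDegree_C_mul (Units.ne_zero _), hQdeg]
  have hP₂d : P₂.IsDistinguishedAt (IsLocalRing.maximalIdeal ℤ_[p]) := by
    refine ⟨⟨fun {n} hn ↦ ?_⟩, ?_⟩
    · rw [hP₂deg] at hn
      rw [hP₂, Polynomial.coeff_C_mul]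
      interval_cases n
      · rw [hQ0]; exact Ideal.mul_mem_left _ _ hm₀
      · rw [hQ1c]; exact Ideal.mul_mem_left _ _ (Ideal.sub_mem _ (Ideal.mul_mem_left _ _ hm₀) hm₁)
    · rw [Polynomial.Monic, Polynomial.leadingCoeff, hP₂deg, hP₂, Polynomial.coeff_C_mul, hQ2, hinv]
  have hQ2fac : (Q : IwasawaAlgebra p).IsWeierstrassFactorization P₂ (PowerSeries.C c) := by
    refine ⟨hP₂d, ?_, ?_⟩
    · rw [PowerSeries.isUnit_iff_constantCoeff, constantCoeff_C, ← hcu]; exact Units.isUnit _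
    · have : Q = P₂ * Polynomial.C c := by
        rw [hP₂, mul_comm (Polynomial.C _) Q, mul_assoc, ← Polynomial.C_mul, hinv, map_one, mul_one]
      conv_lhs => rw [this]
      rw [Polynomial.coe_mul, Polynomial.coe_C]
  -- uniqueness: `P = P₂`, so `p₀ = c⁻¹ p₀`, `c = 1`, `p₀ = p₁`
  obtain ⟨hPP₂, -⟩ := hQ1.elim hQ2fac
  have h00 : p₀ = ↑cu⁻¹ * p₀ := by
    have := congrArg (fun R : Polynomial ℤ_[p] ↦ R.coeff 0) hPP₂
    rw [← hp₀] at this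
    have e : P₂.coeff 0 = ↑cu⁻¹ * p₀ := by rw [hP₂, Polynomial.coeff_C_mul, hQ0]
    exact this.trans e
  have hcu1 : (↑cu⁻¹ : ℤ_[p]) = 1 := by
    have : (1 - ↑cu⁻¹) * p₀ = 0 := by rw [sub_mul, one_mul, ← h00, sub_self]
    rcases mul_eq_zero.mp this with h1 | h1
    · exact (sub_eq_zero.mp h1).symm
    · exact absurd h1 hp₀ne
  have hc1 : c = 1 := by rw [← hinv, hcu1, one_mul]
  -- `c = 1 − p₁ + p₀ = 1`
  have h := hc1
  rw [hc] at h
  linear_combination h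

end AnyPrime

/-! ## §2 `p = 2`: the two fixed-point values of an `ι`-stable element of `λ = 2` -/

section Two

/-- **Values at the fixed points.** `F ∈ ℤ₂⟦T⟧`, `F ≢ 0 (mod 2)`, `λ(F) = 2`, `F(0) ≠ 0`, `ι`-stable: with `q := p₀ = p₁` the common
coefficient of the distinguished polynomial `T² + qT + q` and the Weierstrass unit `h`, **`F(0) = q·h(0)` and `F(−2) = (4 − q)·h(−2)`**,
`h(0), h(−2) ∈ ℤ₂ˣ`. [cite: Washington1997, §7.1 (Weierstrass preparation, uniqueness)] -/
theorem constantCoeff_and_evalAt_neg_two_eq {F : IwasawaAlgebra 2} (hred : F.map (IsLocalRing.residue ℤ_[2]) ≠ 0) (hlam : lam F = 2)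
    (h0 : PowerSeries.constantCoeff F ≠ 0) (hι : ∃ u : (IwasawaAlgebra 2)ˣ, invol 2 F = u * F) :
    ∃ (q : ℤ_[2]) (v₀ v₂ : ℤ_[2]ˣ), PowerSeries.constantCoeff F = q * v₀ ∧ evalAt (-2 : ℤ_[2]) F = (4 - q) * v₂ := by
  set P : Polynomial ℤ_[2] := F.weierstrassDistinguished hred with hP
  set h : IwasawaAlgebra 2 := F.weierstrassUnit hred with hh
  have hPd : P.IsDistinguishedAt (IsLocalRing.maximalIdeal ℤ_[2]) := F.isDistinguishedAt_weierstrassDistinguished hred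
  have hhU : IsUnit h := F.isUnit_weierstrassUnit hred
  have hfac : F = (P : IwasawaAlgebra 2) * h := F.eq_weierstrassDistinguished_mul_weierstrassUnit hred
  have hdeg : P.natDegree = 2 := by
    have hF1 : F = PowerSeries.C ((2 : ℤ_[2]) ^ 0) * F := by rw [pow_zero, map_one, one_mul]
    have := lam_eq_natDegree_weierstrassDistinguished (p := 2) hF1 hred
    rw [← this, hlam]
  have hq : P.coeff 0 = P.coeff 1 := coeff_zero_eq_coeff_one_of_invol hred hlam h0 hι
  set q : ℤ_[2] := P.coeff 1 with hqdef
  have hPeq : P = Polynomial.X ^ 2 + Polynomial.C q * Polynomial.X + Polynomial.C q := by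
    have h' := hPd.monic.as_sum
    rw [hdeg] at h'
    rw [h']
    simp [Finset.sum_range_succ, hq]
    ring
  -- the unit values `h(0)`, `h(−2)`
  have hn2 : ‖(-2 : ℤ_[2])‖ < 1 := norm_neg_two_lt_one
  have hh0 : IsUnit (PowerSeries.constantCoeff h) := PowerSeries.isUnit_iff_constantCoeff.mp hhU
  have hh2 : IsUnit (evalAt (-2 : ℤ_[2]) h) := by
    have := hhU.map (evalAtHom hn2); rwa [evalAtHom_apply] at this
  refine ⟨q, hh0.unit, hh2.unit, ?_, ?_⟩
  · rw [hfac, map_mul, Polynomial.constantCoeff_coe, hq, IsUnit.unit_spec]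
  · rw [hfac, evalAt_mul hn2, evalAt_coe, hPeq, IsUnit.unit_spec]
    simp only [Polynomial.eval_add, Polynomial.eval_mul, Polynomial.eval_pow, Polynomial.eval_X, Polynomial.eval_C]
    ring

/-- ★★★ **THE DOUBLY-DARK TWIN EXCLUDES `λ = 2` (divisibility form).** `F ∈ ℤ₂⟦T⟧` `ι`-stable with `μ(F) = 0`, `λ(F) = 2`, and `F(0)` of
order EXACTLY `2` (`4 ∣ F(0)`, `8 ∤ F(0)`): then **`8 ∣ F(−2)`** — so `F(−2) = 0` (the shape `(T+2)²·unit`) or `ord₂ F(−2) ≥ 3`; in particular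
`ord₂ F(−2) ≠ 2`. (`F(0) = q·v₀`, `F(−2) = (4 − q)·v₂`, `q = 4·odd`.) [cite: Washington1997, §7.1 (Weierstrass preparation, uniqueness)]
[cite: MazurTateTeitelbaum1986Invent, Ch. I §17] -/
theorem eight_dvd_evalAt_neg_two_of_lam_eq_two {F : IwasawaAlgebra 2} (hF : F ≠ 0) (hμ : mu F = 0) (hlam : lam F = 2)
    (hι : ∃ u : (IwasawaAlgebra 2)ˣ, invol 2 F = u * F) (h4 : (2 : ℤ_[2]) ^ 2 ∣ PowerSeries.constantCoeff F)
    (h8 : ¬ (2 : ℤ_[2]) ^ 3 ∣ PowerSeries.constantCoeff F) : (2 : ℤ_[2]) ^ 3 ∣ evalAt (-2 : ℤ_[2]) F := by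
  have hred : F.map (IsLocalRing.residue ℤ_[2]) ≠ 0 := by
    have h := eq_C_pow_mu_mul_pfree F
    rw [hμ, pow_zero, map_one, one_mul] at h
    rw [h]; exact red_pfree_ne_zero hF
  have h0 : PowerSeries.constantCoeff F ≠ 0 := fun h ↦ h8 (by rw [h]; exact dvd_zero _)
  obtain ⟨q, v₀, v₂, hF0, hF2⟩ := constantCoeff_and_evalAt_neg_two_eq hred hlam h0 hι
  -- `4 ∣ q` and `8 ∤ q`
  have h4q : (2 : ℤ_[2]) ^ 2 ∣ q := by
    have : (2 : ℤ_[2]) ^ 2 ∣ q * v₀ := by rw [← hF0]; exact h4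
    exact (IsUnit.dvd_mul_right v₀.isUnit).mp this
  have h8q : ¬ (2 : ℤ_[2]) ^ 3 ∣ q := fun h ↦ h8 (by rw [hF0]; exact Dvd.dvd.mul_right h _)
  obtain ⟨t, ht⟩ := h4q
  -- `t` is a unit: otherwise `8 ∣ q`
  have htU : IsUnit t := by
    by_contra htn
    have htm : t ∈ IsLocalRing.maximalIdeal ℤ_[2] := (IsLocalRing.mem_maximalIdeal t).mpr (mem_nonunits_iff.mpr htn)
    rw [PadicInt.maximalIdeal_eq_span_p, Ideal.mem_span_singleton] at htm
    obtain ⟨s, hs⟩ := htm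
    apply h8q
    refine ⟨s, ?_⟩
    rw [ht, hs]; push_cast; ring
  -- a unit of `ℤ₂` is `≡ 1 (mod 2)`
  have h1t : (2 : ℤ_[2]) ∣ 1 - t := by
    have hu : IsUnit (PadicInt.toZMod (p := 2) t) := htU.map _
    have h1 : PadicInt.toZMod (p := 2) t = 1 := by
      obtain ⟨w, hw⟩ := hu
      have hall : ∀ w' : (ZMod 2)ˣ, w' = 1 := by decide
      rw [← hw, hall w, Units.val_one]
    have hmem : 1 - t ∈ RingHom.ker (PadicInt.toZMod (p := 2)) := by
      rw [RingHom.mem_ker, map_sub, map_one, h1, sub_self]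
    rw [PadicInt.ker_toZMod, PadicInt.maximalIdeal_eq_span_p, Ideal.mem_span_singleton] at hmem
    simpa using hmem
  obtain ⟨s, hs⟩ := h1t
  refine ⟨s * v₂, ?_⟩
  rw [hF2, ht]
  have : (4 : ℤ_[2]) - 2 ^ 2 * t = 2 ^ 2 * (1 - t) := by ring
  rw [this, hs]; ring

/-- ★★★ **THE DOUBLY-DARK TWIN EXCLUDES `λ = 2`.** `F ∈ ℤ₂⟦T⟧`, `F ≠ 0`, `ι`-stable, `μ(F) = 0`, with `F(0) ≠ 0`, `F(−2) ≠ 0` both of `2`-adic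
order exactly `2` ⟹ **`λ(F) ≠ 2`**. [cite: Washington1997, §7.1 (Weierstrass preparation, uniqueness)] [cite: MazurTateTeitelbaum1986Invent, Ch. I §17] -/
theorem lam_ne_two_of_twin_two_two {F : IwasawaAlgebra 2} (hF : F ≠ 0) (hμ : mu F = 0)
    (hι : ∃ u : (IwasawaAlgebra 2)ˣ, invol 2 F = u * F) (hc0 : PowerSeries.constantCoeff F ≠ 0)
    (h2 : evalAt (-2 : ℤ_[2]) F ≠ 0) (ha : (PowerSeries.constantCoeff F).valuation = 2)
    (hb : (evalAt (-2 : ℤ_[2]) F).valuation = 2) : lam F ≠ 2 := by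
  intro hlam
  have h4 : (2 : ℤ_[2]) ^ 2 ∣ PowerSeries.constantCoeff F := (two_pow_dvd_iff_le_valuation hc0 2).mpr (by omega)
  have h8 : ¬ (2 : ℤ_[2]) ^ 3 ∣ PowerSeries.constantCoeff F := fun h ↦ by
    have := (two_pow_dvd_iff_le_valuation hc0 3).mp h
    omega
  have h8' := (two_pow_dvd_iff_le_valuation h2 3).mp (eight_dvd_evalAt_neg_two_of_lam_eq_two hF hμ hlam hι h4 h8)
  omega

/-- ★★★ **On the doubly-dark twin `μ = 0` forces `λ ≥ 4`.** Same hypotheses: `λ(F)` is even (g49's `even_lam_of_iotaStable`, the `p = 2`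
parity at the two fixed points), `≠ 0` (`F(0)` is not a unit) and `≠ 2` (above), hence **`4 ≤ λ(F)`**. [cite: GreenbergLNM1716, §5 p. 181]
[cite: Washington1997, §7.1 (Weierstrass preparation, uniqueness)] -/
theorem four_le_lam_of_twin_two_two {F : IwasawaAlgebra 2} (hF : F ≠ 0) (hμ : mu F = 0)
    (hι : ∃ u : (IwasawaAlgebra 2)ˣ, invol 2 F = u * F) (hc0 : PowerSeries.constantCoeff F ≠ 0)
    (h2 : evalAt (-2 : ℤ_[2]) F ≠ 0) (ha : (PowerSeries.constantCoeff F).valuation = 2)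
    (hb : (evalAt (-2 : ℤ_[2]) F).valuation = 2) : 4 ≤ lam F := by
  have hne2 := lam_ne_two_of_twin_two_two hF hμ hι hc0 h2 ha hb
  have heven : Even (lam F) := even_lam_of_iotaStable' hF hι hc0 h2
  -- `λ ≠ 0`: `μ = 0` and `λ = 0` would make `F` a unit, but `4 ∣ F(0)`
  have hne0 : lam F ≠ 0 := by
    intro h0
    have hU : IsUnit F := (isUnit_iff_mu_eq_zero_and_lam_eq_zero F).mpr ⟨hF, hμ, h0⟩
    have hU0 : IsUnit (PowerSeries.constantCoeff F) := PowerSeries.isUnit_iff_constantCoeff.mp hU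
    have h4 : (2 : ℤ_[2]) ^ 2 ∣ PowerSeries.constantCoeff F := (two_pow_dvd_iff_le_valuation hc0 2).mpr (by omega)
    have h2u : IsUnit ((2 : ℤ_[2]) ^ 2) := isUnit_of_dvd_unit h4 hU0
    have h2u' : IsUnit (2 : ℤ_[2]) := (isUnit_pow_iff (by norm_num)).mp h2u
    have hn : ‖(2 : ℤ_[2])‖ = 1 := PadicInt.isUnit_iff.mp h2u'
    have hn' : ‖(2 : ℤ_[2])‖ = (2 : ℝ)⁻¹ := by
      have h := PadicInt.norm_p (p := 2)
      norm_num at h ⊢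
      exact h
    rw [hn'] at hn
    norm_num at hn
  obtain ⟨k, hk⟩ := heven
  omega

end Two

/-! ## §3 C2's datum: a doubly-dark class has `μ ≥ 1` or `λ ≥ 4` -/

section Datum

variable (κ : ZpExtension ℚ 2) (hκ : κ.IsCyclotomic) {γ : Field.absoluteGaloisGroup ℚ} (hγ : κ.IsTopGenerator γ)
  (hγ' : IsCyclotomicVariable 2 γ) (W : WeierstrassCurve ℚ) [W.IsElliptic] [W.IsGloballyMinimal]

include hκ hγ hγ' in
/-- ★★★ **DOUBLY DARK AND `μ = 0` FORCE `λ(X) ≥ 4`.** `W/ℚ` globally minimal, good ordinary at `2`, `Sel_{2^∞}(W/ℚ)` finite, `(κ, γ)` the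
normalised cyclotomic datum, `D` any dual datum, `f_X` a generator of `char_Λ D.X` with `f_X(−2) ≠ 0`; Euler weight `w = ord₂ ∏c_ℓ + 2e + s − 2t
= 2` (the clean cell) and the displayed TWIN VALUE `ord₂ f_X(−2) = 2` («doubly dark»); PRINT `h114` (Thm. 1.14). If `μ(X(W/ℚ_∞)) = 0` then
**`λ(X(W/ℚ_∞)) ≥ 4`** — the layer-2 value door (`λ = 2`) is silent on every doubly-dark class, the first boundary door that can fire is layer `3`.
[cite: GreenbergLNM1716, Thm. 1.14 (p. 68), Thm. 4.1 (p. 102), §5 p. 181] [cite: MazurTateTeitelbaum1986Invent, Ch. I §17] -/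
theorem four_le_lambda_of_doublyDark_of_mu_eq_zero (h114 : Greenberg1999_thm114_charIdeal_iota_invariant) (hord : IsOrdinaryAt W 2)
    (D : W.SelmerDualData κ γ) (hfin : Finite (W.selmerGroupPInfty 2)) {t e s : ℕ}
    (ht : Nat.card (AddCommGroup.primaryComponent W.toAffine.Point 2) = 2 ^ t)
    (he : Nat.card (AddCommGroup.primaryComponent ((integralModelInt W).map (Int.castRingHom (ZMod 2))).toAffine.Point 2) = 2 ^ e)
    (hs : Nat.card (W.selmerGroupPInfty 2) = 2 ^ s) (hw : padicValNat 2 W.tamagawaProduct + 2 * e + s - 2 * t = 2)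
    {fX : IwasawaAlgebra 2} (hchar : D.charIdeal = Ideal.span {fX}) (h2 : evalAt (-2 : ℤ_[2]) fX ≠ 0)
    (htwin : (evalAt (-2 : ℤ_[2]) fX).valuation = 2) (hμ : D.mu = 0) : 4 ≤ D.lambda := by
  haveI : Module.Finite (IwasawaAlgebra 2) D.X := D.module_finite_holds hγ
  have hD : D.IsTorsion := isTorsion_of_finite κ hκ hγ W hord D hfin
  obtain ⟨-, hnorm⟩ := norm_constantCoeff_charGen_eq_of_thm41 W thm41_charValue_rankZero_anyPrime_holds
    ((isOrdinaryAt_iff W 2).mp hord).1 ((isOrdinaryAt_iff W 2).mp hord).2 hκ hγ hγ' D hD hchar hfin ht he hs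
  obtain ⟨hc0, hval⟩ := valuation_eq_of_norm_eq_two_inv_pow hnorm
  rw [hw] at hval
  have hfXne : fX ≠ 0 := fun h0 ↦ hc0 (by rw [h0, map_zero])
  have hι := iotaStable_charGen_of_thm114 h114 W hord hκ hγ D hD hchar
  have hmufX : mu fX = D.mu := mu_generator_eq_muInvariant D.X hD hfXne hchar
  have hlamfX : lam fX = D.lambda := lam_generator_eq_lambdaInvariant D.X hD hfXne hchar
  have hμf : mu fX = 0 := by rw [hmufX, hμ]
  rw [← hlamfX]
  exact four_le_lam_of_twin_two_two hfXne hμf hι hc0 h2 hval htwin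

include hκ hγ hγ' in
/-- ★★ **Contrapositive: on a doubly-dark class, `λ(X) ≤ 3` forces `μ(X) ≥ 1`.** Same data; in particular, GIVEN Kato's divisibility
`λ(X) ≤ λ_an` (17.4 (2)), a doubly-dark seed with analytic `λ_an ≤ 3` would be a counterexample to Greenberg's `μ`-conjecture at `2` — the
census finds `λ_an ≥ 4` on every doubly-dark seed it can see (14/14). [cite: GreenbergLNM1716, Thm. 1.14 (p. 68), Thm. 4.1 (p. 102)]
[cite: Kato2004Asterisque, Thm. 17.4 (2)] -/
theorem one_le_mu_of_doublyDark_of_lambda_le_three (h114 : Greenberg1999_thm114_charIdeal_iota_invariant) (hord : IsOrdinaryAt W 2)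
    (D : W.SelmerDualData κ γ) (hfin : Finite (W.selmerGroupPInfty 2)) {t e s : ℕ}
    (ht : Nat.card (AddCommGroup.primaryComponent W.toAffine.Point 2) = 2 ^ t)
    (he : Nat.card (AddCommGroup.primaryComponent ((integralModelInt W).map (Int.castRingHom (ZMod 2))).toAffine.Point 2) = 2 ^ e)
    (hs : Nat.card (W.selmerGroupPInfty 2) = 2 ^ s) (hw : padicValNat 2 W.tamagawaProduct + 2 * e + s - 2 * t = 2)
    {fX : IwasawaAlgebra 2} (hchar : D.charIdeal = Ideal.span {fX}) (h2 : evalAt (-2 : ℤ_[2]) fX ≠ 0)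
    (htwin : (evalAt (-2 : ℤ_[2]) fX).valuation = 2) (hlam : D.lambda ≤ 3) : 1 ≤ D.mu := by
  by_contra hμ
  have hμ0 : D.mu = 0 := by omega
  have := four_le_lambda_of_doublyDark_of_mu_eq_zero κ hκ hγ hγ' W h114 hord D hfin ht he hs hw hchar h2 htwin hμ0
  omega

end Datum

end Summit.BirchSwinnertonDyer.BirchSwinnertonDyer.Theorems.AlignedTransportAtTwoLayerValueDoublyDark

end
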